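/-
Copyright (c) 2026. All rights reserved.
Released under Apache 2.0 license as described in the file LICENSE.
Authors: abc-iut cell, statement-typer seat abc-iut-L4-t3 (wave 1; gen 8).
-/
import Mathlib.Algebra.Group.ULift
import Mathlib.CategoryTheory.SingleObj
import Literature.AnabelianGeometry.AbsoluteAnabelian.LogFrobeniusIotaEtaSquare
import Literature.AnabelianGeometry.AbsoluteAnabelian.LogFrobeniusSettingNonVacuity
import HarnessLib

/-!
# [AbsTopIII] Corollary 5.10 (iv)(c): the `η⊢`-naturality square is NOT a consequence of the interface — an independence witness

S. Mochizuki, *Topics in absolute anabelian geometry III: global reconstruction algorithms*,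
J. Math. Sci. Univ. Tokyo 22 (2015) 939–1156 [MochizukiAbsTopIII2015]; locators `p.N` = pages of the author's
manuscript (`paper:url-5493eb38cbb7`), read on the page (own render): Cor 5.10 (iv)(c) p. 148 l. 39–51 (the homotopies
`η⊢_{v,ν}`, the mono-analyticization homotopies and the `ι^{An⊢⊞}_{v,ε}`-homotopies generate ONE contact structure `ℋ_{An⊢}`,
compatible with the `ι⊞_{v,ε}`-homotopies of `S_log⊞`, `ε ∈ Γ⃗×_v`); Def 3.5 (ii) p. 75 (one homotopy per boundary pair);
Prop 5.8 (vii) p. 142 (`ι^{An⊢⊞}_{w,ε}`); Def 5.4 (vii) p. 128 (`ι⊞_{v,ε}`).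

PROOF-SIDE COMPANION of `LogFrobeniusIotaEtaSquare.lean` (this lineage): there the printed compatibility was typed as
the `Prop` `MonoTelecoreCoherence.EtaNatural K I` on the data `(K, I)` = (`η⊢` with its coherences, `ι^{An⊢⊞}` with
"lies over `Th⊢[Z]`") and shown SATISFIABLE (tagged setting).  This file shows it is a GENUINE CONSTRAINT: over every
index set with a nonarchimedean place there is a setting carrying ALL the add-on data of Cor 5.10 (iv) —
mono-analyticization homotopies `M`, a coherence datum `K` (`ψ` over `ℰ⊢`, `η⊢`, `η⊢` over `ℰ⊢`) and `ι^{An⊢⊞}`-data `I`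
over `ℰ⊢` (`ι_over`) — at which `K.EtaNatural I` FAILS (`exists_monoTelecoreCoherence_not_etaNatural`).  So no
theorem "interface + `IotaOver`-type coherences ⇒ `EtaNatural`" exists: the square is independent printed content (the
edge-indexed part of "compatible" in Cor 5.10 (iv)(c)), exactly as abc-iut-f-101's `IotaSquaresCommute` is for
Cor 5.5 (iii) (`exists_not_forall_iotaSquaresCommute`).

The witness (`monoidTagged`): the diagonal setting on a category `C` with fibre the one-object category of a monoid
`Mo` — `𝒩⊞_v = 𝒩⊢⊞_v := C × SingleObj Mo`, `λ⊞_{v,ν} = ψ^{An⊢⊞}_{v,ν} := (𝟭, ⋆)`, `ι⊞_{v,ε} := (𝟙, 1)`, every `η⊢` and every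
coherence an identity — and `ι^{An⊢⊞}_{v,ε} := (𝟙, m)` for a fixed `m : Mo` (`monoidTaggedIotaAnMono m`; natural, and over
`Th⊢[Z]` on the nose for EVERY `m`).  Along any edge of `Γ⃗×_v` the square reads `1 = m` in `Mo`
(`monoidTagged_etaNatural_iff`), so it holds iff `m = 1`.  DEGENERATE calibration device (no arithmetic content); it
varies only the fibre component of `ι^{An⊢⊞}` (its image over `Th⊢[Z]` is pinned to the identity by `ι_over`), which none
of the three add-on coherences (`ι_over`, `psiOver`, `eta_over`) constrains.  Refereed pre-IUT material; nothing here
bears on [IUTchIII] Cor. 3.12; OUR kernel check, no side taken; typed ≠ proved.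
-/

set_option autoImplicit false

universe u

open CategoryTheory

namespace Literature.AnabelianGeometry.AbsoluteAnabelian

namespace LogFrobeniusSetting

variable (Vmod : Type u) (isArc : Vmod → Bool)
variable (C : Type (u + 1)) [Category.{u} C] (Mo : Type u) [Monoid Mo]

/-- **The monoid-tagged setting** on a category `C` with fibre monoid `Mo`: the diagonal setting (every base category `C`,
every structure functor the identity) EXCEPT `𝒩⊞_v = 𝒩⊢⊞_v := C × SingleObj Mo`, `𝒩⊞_v → 𝒩_v` and `𝒩⊢⊞_v → 𝒩⊢_v` the first
projection, `λ⊞_{v,ν} = ψ^{An⊢⊞}_{v,ν} := (𝟭, ⋆)` and `ι⊞_{v,ε} := (𝟙, 1)`.  DEGENERATE calibration device (no arithmetic content).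
[cite: MochizukiAbsTopIII2015, Cor 5.10 (iv)(c) p. 148] -/
def monoidTagged : LogFrobeniusSetting Vmod isArc where
  X := C
  E := C
  proj := 𝟭 C
  log := 𝟭 C
  logIsoId := Iso.refl _
  logOver := Iso.refl _
  Nplus := fun _ => C × SingleObj Mo
  N := fun _ => C
  forget := fun _ => CategoryTheory.Prod.fst C (SingleObj Mo)
  toE := fun _ => 𝟭 C
  lam := fun _ _ => (𝟭 C).prod' ((Functor.const C).obj (SingleObj.star Mo))
  lamOver := fun _ _ => Iso.refl _
  lam_spaceLink_eq_postLog := fun _ => rfl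
  iota := fun _ ν₁ _ _ =>
    eqToHom (_root_.Literature.AnabelianGeometry.AbsoluteAnabelian.frobeniusTwist_id_comp _ ν₁.isPostLog) ≫
      NatTrans.prod' (𝟙 (𝟭 C)) (𝟙 ((Functor.const C).obj (SingleObj.star Mo)))
  An := C
  κAn := CategoryTheory.Equivalence.refl
  φAn := 𝟭 C
  φAn_isEquivalence := inferInstance
  ηAn := Iso.refl _
  κAn₂ := CategoryTheory.Equivalence.refl
  Emono := C
  monoAn := 𝟭 C
  NmonoPlus := fun _ => C × SingleObj Mo
  Nmono := fun _ => C
  forgetMono := fun _ => CategoryTheory.Prod.fst C (SingleObj Mo)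
  toEmono := fun _ => 𝟭 C
  monoNplus := fun _ => 𝟭 _
  monoN := fun _ => 𝟭 C
  monoHomotopy := fun _ => Iso.refl _
  AnMono := C
  κAnMono := CategoryTheory.Equivalence.refl
  ψAnMono := fun _ _ => (𝟭 C).prod' ((Functor.const C).obj (SingleObj.star Mo))

/-- The monoid-tagged setting carries the mono-analyticization homotopies of Def 5.6 (iv) / Cor 5.10 preamble (both
squares commute strictly). [cite: MochizukiAbsTopIII2015, Cor 5.10 p. 146] -/
def monoidTaggedMonoHomotopies : (monoidTagged Vmod isArc C Mo).MonoAnalyticizationHomotopies where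
  toE := fun _ => Iso.refl _
  anToE := Iso.refl _

/-- The monoid-tagged setting carries the coherence add-on of Cor 5.10 (iv)(b)(c): `ψ` over `ℰ⊢`, `η⊢_{v,ν}`, `η⊢` over `ℰ⊢`,
all by identities. [cite: MochizukiAbsTopIII2015, Cor 5.10 (iv)(c) p. 148] -/
def monoidTaggedCoherence :
    (monoidTagged Vmod isArc C Mo).MonoTelecoreCoherence (monoidTaggedMonoHomotopies Vmod isArc C Mo) where
  psiOver := fun _ _ => Iso.refl _
  eta := fun _ _ _ => Iso.refl _
  eta_over := fun v ν hν y => by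
    change (𝟙 y ≫ 𝟙 y ≫ 𝟙 y : y ⟶ y) = 𝟙 y ≫ 𝟙 y
    simp

variable {Mo}

/-- **`ι^{An⊢⊞}`-data `(𝟙, m)` at the monoid-tagged setting**, for ANY `m : Mo`: natural (the fibre functor is constant), and
over `Th⊢[Z]` on the nose (its `C`-component is the identity) — so `ι_over` does not see `m`.
[cite: MochizukiAbsTopIII2015, Prop 5.8 (vii) p. 142] -/
def monoidTaggedIotaAnMono (m : Mo) :
    (monoidTagged Vmod isArc C Mo).IotaAnMono (monoidTaggedCoherence Vmod isArc C Mo).psiOver where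
  ι _ _ _ _ _ := NatTrans.prod' (𝟙 (𝟭 C))
    ((Functor.const C).map (m : SingleObj.star Mo ⟶ SingleObj.star Mo))
  ι_over w ν₁ ν₂ ε hε X := by
    change 𝟙 X = 𝟙 X ≫ 𝟙 X
    rw [Category.comp_id]

/-- At the monoid-tagged setting the untwisted `ι⊞_{v,ε}` along an edge of `Γ⃗×_v` is `(𝟙, 1)`.
[cite: MochizukiAbsTopIII2015, Def 5.4 (vii) p. 128] -/
theorem monoidTagged_iotaCore (v : Vmod) {ν₁ ν₂ : LogVertex (isArc v)} (ε : LogEdgeTS (isArc v) ν₁ ν₂)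
    (hε : ε.InCore) :
    (monoidTagged Vmod isArc C Mo).iotaCore v ε hε =
      NatTrans.prod' (𝟙 (𝟭 C)) (𝟙 ((Functor.const C).obj (SingleObj.star Mo))) :=
  (monoidTagged Vmod isArc C Mo).iotaPre_eq_of_iota_eq v hε.toLogEdge hε.isCross_src.1 _ rfl

/-- **The square at the monoid-tagged setting, along any edge of `Γ⃗×_v` and at any object, reads `1 = m` in `Mo`**: the
`C`-components of both composites are identities, the fibre components are `1 ≫ 1` and `(1 ≫ m) ≫ 1`.
[cite: MochizukiAbsTopIII2015, Cor 5.10 (iv)(c) p. 148] -/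
theorem monoidTagged_square_iff (m : Mo) (v : Vmod) {ν₁ ν₂ : LogVertex (isArc v)}
    (ε : LogEdgeTS (isArc v) ν₁ ν₂) (hε : ε.InCore) (y : C) :
    ((monoidTaggedCoherence Vmod isArc C Mo).eta v ν₁ hε.isCross_src).hom.app y ≫
        (monoidTagged Vmod isArc C Mo).gammaZeroApp v ε hε y =
      (monoidTaggedIotaAnMono Vmod isArc C m).gammaOneApp v ε hε y ≫
        ((monoidTaggedCoherence Vmod isArc C Mo).eta v ν₂ hε.isCross_tgt).hom.app y ↔ m = 1 := by
  unfold IotaAnMono.gammaOneApp gammaZeroApp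
  rw [monoidTagged_iotaCore]
  constructor
  · intro h
    have h2 := congrArg (fun f => f.2) h
    change (𝟙 (SingleObj.star Mo) ≫ 𝟙 (SingleObj.star Mo)) =
      ((𝟙 (SingleObj.star Mo) ≫ (m : SingleObj.star Mo ⟶ SingleObj.star Mo)) ≫ 𝟙 (SingleObj.star Mo)) at h2
    simpa [SingleObj.id_as_one, SingleObj.comp_as_mul] using h2.symm
  · rintro rfl
    apply Prod.hom_ext
    · change 𝟙 y ≫ 𝟙 y = (𝟙 y ≫ 𝟙 y) ≫ 𝟙 y
      simp only [Category.comp_id]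
    · change (𝟙 (SingleObj.star Mo) ≫ 𝟙 (SingleObj.star Mo)) =
        ((𝟙 (SingleObj.star Mo) ≫ ((1 : Mo) : SingleObj.star Mo ⟶ SingleObj.star Mo)) ≫ 𝟙 (SingleObj.star Mo))
      simp [SingleObj.id_as_one, SingleObj.comp_as_mul]

/-- **`EtaNatural` at the monoid-tagged setting holds iff `m = 1`** (given a nonarchimedean place, so that `Γ⃗×_v` has an
edge; at archimedean places the single edge `k~ ↠ k^×` gives the same equation).
[cite: MochizukiAbsTopIII2015, Cor 5.10 (iv)(c) p. 148] -/
theorem monoidTagged_etaNatural_iff (m : Mo) (v₀ : Vmod) (hv₀ : isArc v₀ = false) (y₀ : C) :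
    (monoidTaggedCoherence Vmod isArc C Mo).EtaNatural (monoidTaggedIotaAnMono Vmod isArc C m) ↔ m = 1 := by
  constructor
  · intro h
    obtain ⟨ν₁, ν₂, ε, hε, -, -⟩ := exists_inCore_unitTag (isArc v₀) hv₀
    exact (monoidTagged_square_iff Vmod isArc C m v₀ ε hε y₀).mp (h v₀ ε hε y₀)
  · intro hm v ν₁ ν₂ ε hε y
    exact (monoidTagged_square_iff Vmod isArc C m v ε hε y).mpr hm

/-- **The `η⊢`-naturality square is NOT a consequence of the interface and the three add-ons.**  Over every index set with
a nonarchimedean place there are a setting `L`, mono-analyticization homotopies `M`, a coherence datum `K` (`ψ` over `ℰ⊢`,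
`η⊢`, `η⊢` over `ℰ⊢`) and `ι^{An⊢⊞}`-data `I` over `K.psiOver` (lying over `Th⊢[Z]`) such that `K.EtaNatural I` FAILS — the
monoid-tagged setting on the category of types with fibre monoid `ℕ` (written multiplicatively, universe-lifted) and
`ι^{An⊢⊞} := (𝟙, m)` for `m := ofAdd 1`, the additive generator of `ℕ` (so `m ≠ 1`).  Hence the typed square is independent
printed content (Cor 5.10 (iv)(c) "compatible", edge part).
[cite: MochizukiAbsTopIII2015, Cor 5.10 (iv)(c) p. 148] -/
theorem exists_monoTelecoreCoherence_not_etaNatural (v₀ : Vmod) (hv₀ : isArc v₀ = false) :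
    ∃ (L : LogFrobeniusSetting Vmod isArc) (M : L.MonoAnalyticizationHomotopies) (K : L.MonoTelecoreCoherence M)
      (I : K.IotaData), ¬ K.EtaNatural I := by
  refine ⟨monoidTagged Vmod isArc (Type u) (ULift.{u} (Multiplicative ℕ)),
    monoidTaggedMonoHomotopies Vmod isArc (Type u) (ULift.{u} (Multiplicative ℕ)),
    monoidTaggedCoherence Vmod isArc (Type u) (ULift.{u} (Multiplicative ℕ)),
    monoidTaggedIotaAnMono Vmod isArc (Type u) (ULift.up (Multiplicative.ofAdd 1)), fun h => ?_⟩
  have h1 := (monoidTagged_etaNatural_iff Vmod isArc (Type u) (ULift.up (Multiplicative.ofAdd (1 : ℕ))) v₀ hv₀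
    PUnit).mp h
  have h2 := congrArg (fun x : ULift.{u} (Multiplicative ℕ) => Multiplicative.toAdd x.down) h1
  simp at h2

/-- In particular the square is not automatic: it fails somewhere and holds somewhere (`LogFrobeniusIotaEtaSquare`:
`exists_monoTelecoreCoherence_etaNatural`) over the same index set. [cite: MochizukiAbsTopIII2015, Cor 5.10 (iv)(c) p. 148] -/
theorem not_forall_etaNatural (v₀ : Vmod) (hv₀ : isArc v₀ = false) :
    ¬ ∀ (L : LogFrobeniusSetting Vmod isArc) (M : L.MonoAnalyticizationHomotopies) (K : L.MonoTelecoreCoherence M)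
      (I : K.IotaData), K.EtaNatural I := by
  intro h
  obtain ⟨L, M, K, I, hK⟩ := exists_monoTelecoreCoherence_not_etaNatural Vmod isArc v₀ hv₀
  exact hK (h L M K I)

end LogFrobeniusSetting

end Literature.AnabelianGeometry.AbsoluteAnabelian
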